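import Summits.QuantumFields.QCD.Theses.PauliWegnerSea

/-!
# Crux `TiltedFlatness` (K3 of route `PauliWegnerSea`), negative side — the two-well floor

Support file of the standing disprover of item stmt-QuantumFields-11511.  The (conditional)
refutation of clause (b) of `PauliWegnerSea.TiltedFlatness` — relative small balls
`ν_β(F ≤ ε M_β) ≤ C ε^c` with constants uniform in the tilt `β` and in the outside
configuration — rests on the soft `β → ∞` analysis proved here in full generality:

* `laplace_concentration`: on a compact space with a finite measure charging non-empty open sets,
  the tilted weights `exp(-β S)` of a continuous phase `S` concentrate on any open set containing
  the global minimisers of `S` (mass ratio `≤ δ` for all `β ≥ β₀(δ)`);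
* `small_ball_floor`: if the global minimisers of `S` lie in two sets exchanged by a
  measure-preserving continuous involution fixing `S`, and the continuous amplitude `F ≥ 0`
  vanishes on the first and is positive on the second, then for every `ε > 0` some tilt `β ≥ 0` has
  tilted mean `M_β > 0` and `ν_β(F ≤ ε M_β) ≥ 1/4` — the negation of any `β`-uniform power bound;
* continuity in the configuration of `wilsonAction`, of the entries of `wilsonDirac` and of the
  `N_f`-flavour `diracMatrix` (so that the crux's phase and amplitude qualify).

Standard material [folklore]; consumed by `PauliWegnerSeaTiltedFlatnessRefutation.lean`.
-/

namespace Summit.QuantumFields.QCD.Theorems.TiltedFlatnessNegative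

open MeasureTheory Filter Set
open Literature.MathematicalPhysics.QuantumFieldTheory Literature.MathematicalPhysics.QuantumLattice
  Literature.Probability.LatticeModels


section Abstract

variable {X : Type*} [TopologicalSpace X] [CompactSpace X] [MeasurableSpace X]

/-- A continuous real function on a compact space is integrable for every finite measure.
[folklore] -/
theorem integrable_of_continuous [OpensMeasurableSpace X] {μ : Measure X} [IsFiniteMeasure μ]
    {f : X → ℝ} (hf : Continuous f) : Integrable f μ := by
  obtain ⟨C, hC⟩ := isCompact_univ.exists_bound_of_continuousOn hf.continuousOn
  exact (integrable_const C).mono' hf.aestronglyMeasurable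
    (Eventually.of_forall fun x => hC x (mem_univ x))

/-- **Laplace concentration (soft form).** For a continuous phase `S` on a compact space with a
finite measure charging every non-empty open set, the tilted weights `exp(-β S)` concentrate, as
`β → ∞`, on every open set `V` containing all global minimisers of `S`: the tilted mass of `Vᶜ` is
at most `δ` times the total tilted mass for all `β ≥ β₀(δ)`. [folklore] -/
theorem laplace_concentration [OpensMeasurableSpace X] (μ : Measure X) [IsFiniteMeasure μ]
    [μ.IsOpenPosMeasure] {S : X → ℝ} (hS : Continuous S) {V : Set X} (hV : IsOpen V)
    (hmin : ∀ z, (∀ w, S z ≤ S w) → z ∈ V) [Nonempty X] {δ : ℝ} (hδ : 0 < δ) :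
    ∃ β₀ : ℝ, 0 ≤ β₀ ∧ ∀ β : ℝ, β₀ ≤ β →
      ∫ z in Vᶜ, Real.exp (-(β * S z)) ∂μ ≤ δ * ∫ z, Real.exp (-(β * S z)) ∂μ := by
  obtain ⟨z₀, -, hz₀⟩ := isCompact_univ.exists_isMinOn univ_nonempty hS.continuousOn
  have hz₀' : ∀ w, S z₀ ≤ S w := fun w => hz₀ (mem_univ w)
  have hwi : ∀ β : ℝ, Integrable (fun z => Real.exp (-(β * S z))) μ := fun β =>
    integrable_of_continuous (Real.continuous_exp.comp ((continuous_const.mul hS).neg))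
  by_cases hVc : (Vᶜ : Set X) = ∅
  · refine ⟨0, le_rfl, fun β _ => ?_⟩
    rw [hVc, Measure.restrict_empty, integral_zero_measure]
    exact mul_nonneg hδ.le (integral_nonneg fun z => (Real.exp_pos _).le)
  -- the gap `η > 0` between the minimum and the values of `S` on the compact set `Vᶜ`
  obtain ⟨z₁, hz₁, hz₁min⟩ := hV.isClosed_compl.isCompact.exists_isMinOn
    (nonempty_iff_ne_empty.mpr hVc) hS.continuousOn
  set η : ℝ := S z₁ - S z₀ with hη
  have hηpos : 0 < η := by
    rcases (hz₀' z₁).lt_or_eq with hlt | heq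
    · linarith
    · exact absurd (hmin z₁ fun w => heq ▸ hz₀' w) hz₁
  have hgap : ∀ w ∈ Vᶜ, S z₀ + η ≤ S w := fun w hw => by
    have h' : S z₁ ≤ S w := isMinOn_iff.mp hz₁min w hw
    rw [hη]; linarith
  -- the open neighbourhood `G = {S < S z₀ + η/2}` of `z₀` has positive mass
  set G : Set X := {w | S w < S z₀ + η / 2} with hG
  have hGopen : IsOpen G := isOpen_lt hS continuous_const
  have hGpos : 0 < μ G := hGopen.measure_pos μ ⟨z₀, by rw [hG, mem_setOf_eq]; linarith⟩
  have hGreal : 0 < μ.real G := ENNReal.toReal_pos hGpos.ne' (measure_ne_top μ G)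
  have hUreal : 0 < μ.real (univ : Set X) := hGreal.trans_le (measureReal_mono (subset_univ G))
  -- choose `β₀` with `exp(-β₀ η / 2) · μ(univ) ≤ δ · μ(G)`
  set r : ℝ := δ * μ.real G / μ.real (univ : Set X) with hr
  have hrpos : 0 < r := by positivity
  refine ⟨max 0 (-(2 / η) * Real.log r), le_max_left _ _, fun β hβ => ?_⟩
  have hβ0 : 0 ≤ β := le_trans (le_max_left _ _) hβ
  have hexp : Real.exp (-(β * η / 2)) ≤ r := by
    have h1 : -(2 / η) * Real.log r ≤ β := le_trans (le_max_right _ _) hβ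
    have h2 := mul_le_mul_of_nonneg_right h1 (by linarith : (0 : ℝ) ≤ η / 2)
    have h3 : -(2 / η) * Real.log r * (η / 2) = -Real.log r := by field_simp
    calc Real.exp (-(β * η / 2)) ≤ Real.exp (Real.log r) := Real.exp_le_exp.mpr (by linarith)
      _ = r := Real.exp_log hrpos
  -- upper bound on `Vᶜ`, lower bound on the whole space through `G`
  have hup : ∫ z in Vᶜ, Real.exp (-(β * S z)) ∂μ ≤
      Real.exp (-(β * (S z₀ + η))) * μ.real (univ : Set X) := by
    have h1 : ∫ z in Vᶜ, Real.exp (-(β * S z)) ∂μ ≤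
        ∫ z in Vᶜ, Real.exp (-(β * (S z₀ + η))) ∂μ :=
      setIntegral_mono_on (hwi β).integrableOn (integrable_const _).integrableOn
        hV.isClosed_compl.measurableSet fun w hw =>
          Real.exp_le_exp.mpr (neg_le_neg (mul_le_mul_of_nonneg_left (hgap w hw) hβ0))
    rw [setIntegral_const, smul_eq_mul, mul_comm] at h1
    exact h1.trans
      (mul_le_mul_of_nonneg_left (measureReal_mono (subset_univ _)) (Real.exp_pos _).le)
  have hlow : Real.exp (-(β * (S z₀ + η / 2))) * μ.real G ≤ ∫ z, Real.exp (-(β * S z)) ∂μ := by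
    have h1 : ∫ z in G, Real.exp (-(β * (S z₀ + η / 2))) ∂μ ≤
        ∫ z in G, Real.exp (-(β * S z)) ∂μ :=
      setIntegral_mono_on (integrable_const _).integrableOn (hwi β).integrableOn
        hGopen.measurableSet fun w hw =>
          Real.exp_le_exp.mpr (neg_le_neg (mul_le_mul_of_nonneg_left (le_of_lt hw) hβ0))
    rw [setIntegral_const, smul_eq_mul, mul_comm] at h1
    exact h1.trans
      (setIntegral_le_integral (hwi β) (Eventually.of_forall fun z => (Real.exp_pos _).le))
  have hsplit : Real.exp (-(β * (S z₀ + η))) =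
      Real.exp (-(β * (S z₀ + η / 2))) * Real.exp (-(β * η / 2)) := by
    rw [← Real.exp_add]; congr 1; ring
  calc ∫ z in Vᶜ, Real.exp (-(β * S z)) ∂μ
      ≤ Real.exp (-(β * (S z₀ + η / 2))) * (Real.exp (-(β * η / 2)) * μ.real (univ : Set X)) := by
        rw [← mul_assoc, ← hsplit]; exact hup
    _ ≤ Real.exp (-(β * (S z₀ + η / 2))) * (r * μ.real (univ : Set X)) := by gcongr
    _ = δ * (Real.exp (-(β * (S z₀ + η / 2))) * μ.real G) := by rw [hr]; field_simp
    _ ≤ δ * ∫ z, Real.exp (-(β * S z)) ∂μ := by gcongr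

/-- **The two-well floor.** If the phase `S` has its global minimisers inside two sets `O₁`, `O₂`
exchanged by a measure-preserving continuous involution `Φ` leaving `S` invariant, and the
non-negative continuous amplitude `F` vanishes on `O₁` but not on `O₂`, then for every `ε > 0`
there is a tilt `β ≥ 0` at which the tilted mean `M` of `F` is positive and the relative small
ball `{F ≤ ε M}` carries at least a quarter of the tilted mass. [folklore] -/
theorem small_ball_floor [BorelSpace X] (μ : Measure X) [IsProbabilityMeasure μ]
    [μ.IsOpenPosMeasure] {S F : X → ℝ} (hS : Continuous S) (hF : Continuous F) (hF0 : ∀ z, 0 ≤ F z)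
    {O₁ O₂ : Set X} {Φ : X → X} (hO₁ : IsClosed O₁) (hne : O₁.Nonempty)
    (hΦc : Continuous Φ) (hΦi : ∀ z, Φ (Φ z) = z) (hΦμ : MeasurePreserving Φ μ μ)
    (hΦS : ∀ z, S (Φ z) = S z) (h12 : MapsTo Φ O₁ O₂) (h21 : MapsTo Φ O₂ O₁)
    (hargmin : ∀ z, (∀ w, S z ≤ S w) → z ∈ O₁ ∪ O₂)
    (hF1 : ∀ z ∈ O₁, F z = 0) (hF2 : ∀ z ∈ O₂, 0 < F z) {ε : ℝ} (hε : 0 < ε) :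
    ∃ β : ℝ, 0 ≤ β ∧
      0 < (∫ z, F z * Real.exp (-(β * S z)) ∂μ) / (∫ z, Real.exp (-(β * S z)) ∂μ) ∧
      (1 / 4 : ℝ) ≤ (∫ z, (if F z ≤ ε * ((∫ z, F z * Real.exp (-(β * S z)) ∂μ) /
          (∫ z, Real.exp (-(β * S z)) ∂μ)) then (1 : ℝ) else 0) * Real.exp (-(β * S z)) ∂μ) /
        (∫ z, Real.exp (-(β * S z)) ∂μ) := by
  classical
  -- the second well is the `Φ`-preimage of the first: closed, non-empty, `F ≥ 2θ > θ > 0` on it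
  have hO₂eq : O₂ = Φ ⁻¹' O₁ := by
    refine Set.ext fun z => ⟨fun hz => h21 hz, fun hz => ?_⟩
    have h' : Φ (Φ z) ∈ O₂ := h12 hz
    rwa [hΦi] at h'
  have hO₂c : IsClosed O₂ := hO₂eq ▸ hO₁.preimage hΦc
  obtain ⟨z₂, hz₂, hz₂min⟩ :=
    hO₂c.isCompact.exists_isMinOn (let ⟨z, hz⟩ := hne; ⟨Φ z, h12 hz⟩) hF.continuousOn
  set θ : ℝ := F z₂ / 2 with hθ
  have hFz₂ : 0 < F z₂ := hF2 z₂ hz₂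
  have hθpos : 0 < θ := by rw [hθ]; linarith
  have hθO₂ : ∀ z ∈ O₂, θ < F z := fun z hz => by
    have h' : F z₂ ≤ F z := isMinOn_iff.mp hz₂min z hz
    rw [hθ]; linarith
  -- the smallness level `η` and the two open neighbourhoods `T₁`, `T₂ = Φ ⁻¹' T₁`
  set η : ℝ := min θ (ε * θ / 4) with hη
  have hηpos : 0 < η := lt_min hθpos (by positivity)
  have hηθ : η ≤ θ := min_le_left _ _
  have hηε : η ≤ ε * θ / 4 := min_le_right _ _
  set A : Set X := {z | F z < η} with hA
  set B : Set X := {z | θ < F z} with hB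
  have hAo : IsOpen A := isOpen_lt hF continuous_const
  have hBo : IsOpen B := isOpen_lt continuous_const hF
  set T₁ : Set X := A ∩ Φ ⁻¹' B with hT₁
  set T₂ : Set X := B ∩ Φ ⁻¹' A with hT₂
  have hT₁o : IsOpen T₁ := hAo.inter (hBo.preimage hΦc)
  have hT₂o : IsOpen T₂ := hBo.inter (hAo.preimage hΦc)
  have hO₁T₁ : O₁ ⊆ T₁ := fun z hz =>
    ⟨show F z < η by rw [hF1 z hz]; exact hηpos, show θ < F (Φ z) from hθO₂ _ (h12 hz)⟩
  have hO₂T₂ : O₂ ⊆ T₂ := fun z hz =>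
    ⟨hθO₂ z hz, show F (Φ z) < η by rw [hF1 _ (h21 hz)]; exact hηpos⟩
  have hdisj : Disjoint T₁ T₂ := Set.disjoint_left.mpr fun z h1 h2 => by
    have ha : F z < η := h1.1
    have hb : θ < F z := h2.1
    linarith
  have hpre : Φ ⁻¹' T₂ = T₁ := by
    ext z
    simp only [hT₁, hT₂, hA, hB, mem_preimage, mem_inter_iff, mem_setOf_eq, hΦi]
    exact and_comm
  -- Laplace concentration on `T₁ ∪ T₂`
  have hVo : IsOpen (T₁ ∪ T₂) := hT₁o.union hT₂o
  have hminV : ∀ z, (∀ w, S z ≤ S w) → z ∈ T₁ ∪ T₂ := fun z hz =>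
    (hargmin z hz).elim (fun h => Or.inl (hO₁T₁ h)) (fun h => Or.inr (hO₂T₂ h))
  haveI : Nonempty X := let ⟨z, _⟩ := hne; ⟨z⟩
  obtain ⟨β, hβ0, hconc⟩ := laplace_concentration μ hS hVo hminV (by norm_num : (0 : ℝ) < 1 / 2)
  have hconcβ := hconc β le_rfl
  refine ⟨β, hβ0, ?_⟩
  have hwc : Continuous fun z => Real.exp (-(β * S z)) :=
    Real.continuous_exp.comp ((continuous_const.mul hS).neg)
  have hwi : Integrable (fun z => Real.exp (-(β * S z))) μ := integrable_of_continuous hwc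
  have hFwi : Integrable (fun z => F z * Real.exp (-(β * S z))) μ :=
    integrable_of_continuous (hF.mul hwc)
  set Z : ℝ := ∫ z, Real.exp (-(β * S z)) ∂μ with hZ
  set N : ℝ := ∫ z, F z * Real.exp (-(β * S z)) ∂μ with hN
  set I₁ : ℝ := ∫ z in T₁, Real.exp (-(β * S z)) ∂μ with hI₁
  set I₂ : ℝ := ∫ z in T₂, Real.exp (-(β * S z)) ∂μ with hI₂
  have hZpos : 0 < Z := by
    rw [hZ, integral_pos_iff_support_of_nonneg (fun z => (Real.exp_pos _).le) hwi]
    have hsupp : Function.support (fun z => Real.exp (-(β * S z))) = univ :=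
      Set.ext fun z => by simp [(Real.exp_pos _).ne']
    rw [hsupp, measure_univ]
    exact one_pos
  -- the two neighbourhoods carry the same tilted mass (symmetry), hence each at least `Z/4`
  have hsymm : I₂ = I₁ := by
    have hmeas : AEStronglyMeasurable (T₂.indicator fun z => Real.exp (-(β * S z)))
        (Measure.map Φ μ) := by
      rw [hΦμ.map_eq]
      exact (hwc.measurable.indicator hT₂o.measurableSet).aestronglyMeasurable
    calc I₂ = ∫ z, T₂.indicator (fun z => Real.exp (-(β * S z))) z ∂μ :=
          (integral_indicator hT₂o.measurableSet).symm
      _ = ∫ z, T₂.indicator (fun z => Real.exp (-(β * S z))) z ∂(Measure.map Φ μ) := by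
          rw [hΦμ.map_eq]
      _ = ∫ z, T₂.indicator (fun z => Real.exp (-(β * S z))) (Φ z) ∂μ :=
          integral_map hΦμ.measurable.aemeasurable hmeas
      _ = ∫ z, T₁.indicator (fun z => Real.exp (-(β * S z))) z ∂μ := by
          congr 1 with z
          by_cases hz : z ∈ T₁
          · have hz' : Φ z ∈ T₂ := by rw [← hpre] at hz; exact hz
            rw [Set.indicator_of_mem hz', Set.indicator_of_mem hz, hΦS]
          · have hz' : Φ z ∉ T₂ := by rw [← hpre] at hz; exact hz
            rw [Set.indicator_of_notMem hz', Set.indicator_of_notMem hz]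
      _ = I₁ := integral_indicator hT₁o.measurableSet
  have hdecomp : I₁ + I₂ + ∫ z in (T₁ ∪ T₂)ᶜ, Real.exp (-(β * S z)) ∂μ = Z := by
    rw [hI₁, hI₂, ← setIntegral_union hdisj hT₂o.measurableSet hwi.integrableOn hwi.integrableOn]
    exact integral_add_compl hVo.measurableSet hwi
  have hI₁ge : Z / 4 ≤ I₁ := by linarith
  -- the tilted mean is at least `θ/4`
  have hNge : θ * I₂ ≤ N := by
    have h1 : ∫ z, T₂.indicator (fun z => θ * Real.exp (-(β * S z))) z ∂μ ≤ N := by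
      refine integral_mono ((hwi.const_mul θ).indicator hT₂o.measurableSet) hFwi fun z => ?_
      by_cases hz : z ∈ T₂
      · rw [Set.indicator_of_mem hz]
        exact mul_le_mul_of_nonneg_right (le_of_lt hz.1) (Real.exp_pos _).le
      · rw [Set.indicator_of_notMem hz]
        exact mul_nonneg (hF0 z) (Real.exp_pos _).le
    rwa [integral_indicator hT₂o.measurableSet, integral_const_mul] at h1
  have hMge : θ / 4 ≤ N / Z := by
    rw [le_div_iff₀ hZpos]
    have h1 := mul_le_mul_of_nonneg_left hI₁ge hθpos.le
    have h2 : θ * I₁ ≤ N := hsymm ▸ hNge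
    linarith
  have hMpos : 0 < N / Z := lt_of_lt_of_le (by positivity) hMge
  -- the first neighbourhood lies inside the relative small ball `{F ≤ ε N/Z}`
  have hball : I₁ ≤
      ∫ z, (if F z ≤ ε * (N / Z) then (1 : ℝ) else 0) * Real.exp (-(β * S z)) ∂μ := by
    rw [hI₁, ← integral_indicator hT₁o.measurableSet]
    have hmeas : Measurable fun z =>
        (if F z ≤ ε * (N / Z) then (1 : ℝ) else 0) * Real.exp (-(β * S z)) :=
      (Measurable.ite (measurableSet_le hF.measurable measurable_const) measurable_const
        measurable_const).mul hwc.measurable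
    have hint : Integrable (fun z =>
        (if F z ≤ ε * (N / Z) then (1 : ℝ) else 0) * Real.exp (-(β * S z))) μ := by
      refine hwi.mono' hmeas.aestronglyMeasurable (Eventually.of_forall fun z => ?_)
      rw [Real.norm_eq_abs, abs_mul, abs_of_pos (Real.exp_pos _)]
      split_ifs <;> simp [(Real.exp_pos _).le]
    refine integral_mono (hwi.indicator hT₁o.measurableSet) hint fun z => ?_
    by_cases hz : z ∈ T₁
    · have hFz : F z ≤ ε * (N / Z) := by
        have h1 : F z < η := hz.1
        have h2 : ε * (θ / 4) ≤ ε * (N / Z) := mul_le_mul_of_nonneg_left hMge hε.le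
        linarith
      rw [Set.indicator_of_mem hz, if_pos hFz, one_mul]
    · rw [Set.indicator_of_notMem hz]
      exact mul_nonneg (by split_ifs <;> norm_num) (Real.exp_pos _).le
  refine ⟨hMpos, ?_⟩
  rw [le_div_iff₀ hZpos]
  linarith

end Abstract

section Continuity

variable {d L N : ℕ} {G : Type*} [Group G] [TopologicalSpace G] [IsTopologicalGroup G]
  (ρ : G →* Matrix (Fin N) (Fin N) ℂ)

/-- The Wilson action is continuous in the configuration (continuous representation). [folklore] -/
theorem continuous_wilsonAction [NeZero L] (hρ : Continuous ρ) :
    Continuous (wilsonAction (d := d) (L := L) ρ) := by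
  unfold wilsonAction
  refine continuous_finsetSum _ fun p _ => continuous_const.sub ?_
  refine Complex.continuous_re.comp ((hρ.comp ?_).matrix_trace)
  unfold plaquetteHolonomy
  fun_prop

/-- Every entry of the Wilson–Dirac matrix is continuous in the configuration. [folklore] -/
theorem continuous_wilsonDirac_apply (hρ : Continuous ρ) (m r : ℝ)
    (p q : TorusSite 4 L × Fin N × Fin 4) :
    Continuous fun U : GaugeConfig 4 L G => wilsonDirac ρ U m r p q := by
  simp only [wilsonDirac, Matrix.of_apply]
  refine continuous_const.sub (continuous_const.mul (continuous_finsetSum _ fun μ _ => ?_))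
  refine Continuous.add ?_ ?_
  · split_ifs
    · exact continuous_const.mul ((hρ.matrix_elem _ _).comp (continuous_apply _))
    · exact continuous_const
  · split_ifs
    · exact continuous_const.mul ((hρ.matrix_elem _ _).comp ((continuous_apply _).inv))
    · exact continuous_const

end Continuity

/-- The `N_f`-flavour Wilson–Dirac matrix is continuous in the `SU(3)` configuration.
[folklore] -/
theorem continuous_diracMatrix {Nf L : ℕ} [NeZero L] (mq : Fin Nf → ℝ) :
    Continuous fun U : GaugeConfig 4 L (Matrix.specialUnitaryGroup (Fin 3) ℂ) =>
      diracMatrix U mq := by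
  refine continuous_matrix fun i j => ?_
  simp only [diracMatrix, Matrix.reindex_apply, Matrix.submatrix_apply, Matrix.of_apply]
  split_ifs
  · exact continuous_wilsonDirac_apply _ (continuous_fundamentalRep (Fin 3)) _ _ _ _
  · exact continuous_const

end Summit.QuantumFields.QCD.Theorems.TiltedFlatnessNegative
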